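import Summits.ResolutionOfSingularities.ResolutionOfSingularities.Theorems.FrobeniusLadderFInjectiveMacaulayficationDominatingLocFixRegular
import Mathlib.RingTheory.Ideal.Height
import Mathlib.RingTheory.Localization.Ideal
import Mathlib.RingTheory.Localization.LocalizationLocalization
import Mathlib.RingTheory.Localization.AtPrime.Basic
import Mathlib.AlgebraicGeometry.Noetherian
import Mathlib.AlgebraicGeometry.Properties
import Literature.AlgebraicGeometry.Resolution.QuasiExcellentLocalization
import Literature.AlgebraicGeometry.Resolution.GeneralLU
import Literature.AlgebraicGeometry.Resolution.GeneralLUProofs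
import Literature.AlgebraicGeometry.Resolution.QuasiExcellentSchemes
import Literature.AlgebraicGeometry.Resolution.ExcellentRingsFieldProofs
import HarnessLib

/-!
# The SEMI-LOCAL scheme of a Noetherian domain at finitely many primes: domain, Noetherian, prime dictionary, dimension,
# quasi-excellence, and the product-compatible regular blow-up (b1) over it
# (crux `FInjectiveMacaulayfication` stmt-ResolutionOfSingularities-15315, chain w45a; res-L1-w45a-plan-1 RULING R16.56 — brick for
# res-L1-w45a-stub-1's `clusterGrowth_multi` (R16.54 (2), res-L1-w45a-tri-2 22:34:36Z); seat res-L1-w45a-stub-3 g7)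

[OURS · L1 W4.5a] Support file (`--supports stmt-ResolutionOfSingularities-15315 --as helper`); NOT a statement of any manuscript; def-free
(the semi-local submonoid is written out as `⨅ p ∈ P, p.asIdeal.primeCompl`); AI-written (AI review is weaker than expert review).

SETTING. `R` a commutative ring, `P : Finset (PrimeSpectrum R)` a finite set of primes, `M := ⨅ p ∈ P, p.asIdeal.primeCompl` (the elements
outside every `p ∈ P`) and `S` any localisation of `R` at `M` (`[IsLocalization M S]`) — the SEMI-LOCAL RING of `R` at `P`.
* §1 `mem_iInf_primeCompl`, `disjoint_iInf_primeCompl_iff(_exists_le)` — an ideal misses `M` iff it lies in `⋃ P` iff (PRIME AVOIDANCE) it lies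
  in some `p ∈ P`;
* §2 `isDomain` (Noetherian: Mathlib `IsLocalization.isNoetherianRing`); the prime dictionary: every prime of `S` contracts into some `p ∈ P` (`exists_under_le`), each `p ∈ P`
  extends to a prime `pS` contracting to `p` (`isPrime_map`, `comap_map`);
* §3 DIMENSION: `height_le_iSup` / `ringKrullDim_eq_iSup_height : ringKrullDim S = ⨆ p ∈ P, p.asIdeal.height`, with the corollaries
  `ringKrullDim_le_of_forall` / `le_ringKrullDim_of_mem` / `ringKrullDim_eq_of_forall_eq` in terms of the local rings `R_p`
  (`IsLocalization.AtPrime.ringKrullDim_eq_height`);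
* §4 `isQuasiExcellentRing` (tree: localisations of quasi-excellent rings are quasi-excellent, unconditional);
* §5 SCHEME WORDS for `Spec S`: integral, Noetherian, (affine hence separated), quasi-excellent, `topologicalKrullDim = 3` when every `p ∈ P`
  has `dim R_p = 3` — exactly the binders of (b1) `DominatingLocFixRegular.exists_isBlowup_mul_isRegular_of_dim_three`, whence the one-stop
  corollary **`exists_isBlowup_mul_isRegular_semiLocal (hG h081R hP)`**: for every ideal sheaf `J ≠ ⊥` on the semi-local scheme there is
  `𝔟 ≠ ⊥` with `Bl_{J·𝔟}` REGULAR (modulo CP 2019 Thm 1.1, Raynaud–Gruson, CP 2019 Prop 4.4 BY NAME);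
* §6 PER-POINT: any local ring `T` of `R` at `p ∈ P` is a localisation of `S` (`isLocalization_map_primeCompl`), and the localisation of `S`
  at `pS` is a localisation of `R` at `p` (`isLocalizationAtPrime_of_map`).
[folklore: Atiyah–Macdonald Prop. 1.11, 3.11; Matsumura 1987 §4–§5] [cite: Matsumura1987, Thm. 4.1, Ex. 1.6]
[cite: CossartPiltant2019, Thm. 1.1 (i)(ii); Prop. 4.4] [cite: StacksProject, Tag 00DS; Tag 07QU]
-/

-- single-problem summit: the doubled namespace component is forced
set_option linter.dupNamespace false

noncomputable section

universe u

namespace Summit.ResolutionOfSingularities.ResolutionOfSingularities.Theorems.FInjectiveMacaulayfication.SemiLocalScheme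

open CategoryTheory AlgebraicGeometry Literature.AlgebraicGeometry.Resolution
open Summit.ResolutionOfSingularities.ResolutionOfSingularities.Theorems.FInjectiveMacaulayfication

variable {R : Type u} [CommRing R] (P : Finset (PrimeSpectrum R))

/-! ## §1 The semi-local submonoid and prime avoidance -/

/-- Membership in the semi-local submonoid: outside every prime of `P`. [folklore] -/
theorem mem_iInf_primeCompl {r : R} : r ∈ (⨅ p ∈ P, p.asIdeal.primeCompl : Submonoid R) ↔ ∀ p ∈ P, r ∉ p.asIdeal := by
  simp only [Submonoid.mem_iInf, Ideal.mem_primeCompl_iff]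

/-- An ideal misses the semi-local submonoid iff it lies in the union of the primes of `P`. [folklore] -/
theorem disjoint_iInf_primeCompl_iff (I : Ideal R) :
    Disjoint ((⨅ p ∈ P, p.asIdeal.primeCompl : Submonoid R) : Set R) (I : Set R) ↔
      (I : Set R) ⊆ ⋃ p ∈ (P : Set (PrimeSpectrum R)), (p.asIdeal : Set R) := by
  rw [Set.disjoint_left]
  constructor
  · intro h r hr
    by_contra hcon
    refine h ?_ hr
    rw [SetLike.mem_coe, mem_iInf_primeCompl]
    intro p hp hrp
    exact hcon (Set.mem_biUnion (Finset.mem_coe.mpr hp) hrp)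
  · intro h r hrM hrI
    obtain ⟨p, hp, hrp⟩ := Set.mem_iUnion₂.mp (h hrI)
    exact ((mem_iInf_primeCompl P).mp hrM) p (Finset.mem_coe.mp hp) hrp

/-- **Prime avoidance form**: an ideal misses the semi-local submonoid iff it is contained in one of the primes of `P`.
[cite: Matsumura1987, Ex. 1.6] [cite: StacksProject, Tag 00DS] -/
theorem disjoint_iInf_primeCompl_iff_exists_le (I : Ideal R) :
    Disjoint ((⨅ p ∈ P, p.asIdeal.primeCompl : Submonoid R) : Set R) (I : Set R) ↔ ∃ p ∈ P, I ≤ p.asIdeal := by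
  rw [disjoint_iInf_primeCompl_iff]
  rcases P.eq_empty_or_nonempty with hP | ⟨a, _⟩
  · subst hP
    simp only [Finset.coe_empty, Set.mem_empty_iff_false, Set.iUnion_of_empty, Set.iUnion_empty, Set.subset_empty_iff,
      Finset.notMem_empty, false_and, exists_false, iff_false]
    exact fun h => (Set.eq_empty_iff_forall_notMem.mp h) 0 (Submodule.zero_mem I)
  · exact Ideal.subset_union_prime a a (fun p _ _ _ => p.isPrime)

/-- The primes of `P` themselves miss the semi-local submonoid. [folklore] -/
theorem disjoint_of_mem {p : PrimeSpectrum R} (hp : p ∈ P) :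
    Disjoint ((⨅ p ∈ P, p.asIdeal.primeCompl : Submonoid R) : Set R) (p.asIdeal : Set R) :=
  (disjoint_iInf_primeCompl_iff_exists_le P p.asIdeal).mpr ⟨p, hp, le_rfl⟩

/-- The semi-local submonoid of a NONEMPTY prime set in a domain consists of non-zero-divisors. [folklore] -/
theorem iInf_primeCompl_le_nonZeroDivisors [IsDomain R] (hP : P.Nonempty) :
    (⨅ p ∈ P, p.asIdeal.primeCompl : Submonoid R) ≤ nonZeroDivisors R := by
  intro r hr
  obtain ⟨p, hp⟩ := hP
  refine mem_nonZeroDivisors_of_ne_zero fun h0 => ?_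
  exact ((mem_iInf_primeCompl P).mp hr) p hp (h0 ▸ Submodule.zero_mem _)

/-! ## §2 The semi-local ring: domain, Noetherian, prime dictionary -/

variable (S : Type u) [CommRing S] [Algebra R S] [IsLocalization (⨅ p ∈ P, p.asIdeal.primeCompl : Submonoid R) S]

include P

/-- The semi-local ring of a domain at a nonempty prime set is a domain. [folklore] -/
theorem isDomain [IsDomain R] (hP : P.Nonempty) : IsDomain S :=
  IsLocalization.isDomain_of_le_nonZeroDivisors (M := (⨅ p ∈ P, p.asIdeal.primeCompl : Submonoid R)) S
    (iInf_primeCompl_le_nonZeroDivisors P hP)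

/-- **Prime dictionary, I**: every prime of the semi-local ring contracts into one of the primes of `P`. [cite: Matsumura1987, Thm. 4.1] -/
theorem exists_under_le (Q : Ideal S) [Q.IsPrime] : ∃ p ∈ P, Q.under R ≤ p.asIdeal :=
  (disjoint_iInf_primeCompl_iff_exists_le P (Q.under R)).mp
    ((IsLocalization.isPrime_iff_isPrime_disjoint (⨅ p ∈ P, p.asIdeal.primeCompl : Submonoid R) S Q).mp ‹_›).2

/-- **Prime dictionary, II**: each `p ∈ P` extends to a prime `pS` of the semi-local ring. [cite: Matsumura1987, Thm. 4.1] -/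
theorem isPrime_map {p : PrimeSpectrum R} (hp : p ∈ P) : (p.asIdeal.map (algebraMap R S)).IsPrime :=
  IsLocalization.isPrime_of_isPrime_disjoint (⨅ p ∈ P, p.asIdeal.primeCompl : Submonoid R) S p.asIdeal p.isPrime (disjoint_of_mem P hp)

/-- **Prime dictionary, III**: `pS` contracts back to `p`. [cite: Matsumura1987, Thm. 4.1] -/
theorem comap_map {p : PrimeSpectrum R} (hp : p ∈ P) : (p.asIdeal.map (algebraMap R S)).comap (algebraMap R S) = p.asIdeal :=
  IsLocalization.under_map_of_isPrime_disjoint (⨅ p ∈ P, p.asIdeal.primeCompl : Submonoid R) S p.isPrime (disjoint_of_mem P hp)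

/-- `pS ≠ ⊤` for `p ∈ P`. [folklore] -/
theorem map_ne_top {p : PrimeSpectrum R} (hp : p ∈ P) : p.asIdeal.map (algebraMap R S) ≠ ⊤ :=
  (isPrime_map P S hp).ne_top

/-! ## §3 Dimension: `dim S = max_{p ∈ P} ht p = max_{p ∈ P} dim R_p` -/

/-- Every prime of the semi-local ring has height at most `max_{p ∈ P} ht p`. [cite: Matsumura1987, Thm. 4.1, §5] -/
theorem height_le_iSup (Q : Ideal S) [Q.IsPrime] : Q.height ≤ ⨆ p ∈ P, p.asIdeal.height := by
  obtain ⟨p, hp, hle⟩ := exists_under_le P S Q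
  rw [← IsLocalization.height_under (⨅ p ∈ P, p.asIdeal.primeCompl : Submonoid R) Q]
  exact le_trans (Ideal.height_mono hle) (le_iSup₂ (f := fun p _ => p.asIdeal.height) p hp)

/-- For `p ∈ P`, `ht (pS) = ht p`. [cite: Matsumura1987, §5] -/
theorem height_map {p : PrimeSpectrum R} (hp : p ∈ P) : (p.asIdeal.map (algebraMap R S)).height = p.asIdeal.height :=
  IsLocalization.height_map_of_disjoint (⨅ p ∈ P, p.asIdeal.primeCompl : Submonoid R) p.asIdeal (disjoint_of_mem P hp)

/-- **The dimension of the semi-local ring is the maximum of the heights of the primes of `P`.** [cite: Matsumura1987, §5] -/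
theorem ringKrullDim_eq_iSup_height (hP : P.Nonempty) : ringKrullDim S = ↑(⨆ p ∈ P, p.asIdeal.height) := by
  apply le_antisymm
  · exact (ringKrullDim_le_iff_height_le _).mpr fun Q hQ => WithBot.coe_le_coe.mpr (height_le_iSup P S Q)
  · obtain ⟨p₀, hp₀⟩ := hP
    haveI := isPrime_map P S hp₀
    haveI : Nontrivial S := ⟨⟨0, 1, fun h => (map_ne_top P S hp₀) (Ideal.eq_top_of_isUnit_mem _ (Submodule.zero_mem _)
      (h ▸ isUnit_one))⟩⟩
    rw [← Ideal.sup_isPrime_height_eq_ringKrullDim]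
    refine WithBot.coe_le_coe.mpr (iSup₂_le fun p hp => ?_)
    haveI := isPrime_map P S hp
    rw [← height_map P S hp]
    exact le_iSup₂ (f := fun (I : Ideal S) (_ : I.IsPrime) => I.height) (p.asIdeal.map (algebraMap R S)) (isPrime_map P S hp)

/-- The dimension of the semi-local ring is bounded by a common bound on the local dimensions `dim R_p`, `p ∈ P`.
[cite: Matsumura1987, §5] -/
theorem ringKrullDim_le_of_forall (n : ℕ) (h : ∀ p ∈ P, ringKrullDim (Localization.AtPrime p.asIdeal) ≤ n) : ringKrullDim S ≤ n := by
  refine (ringKrullDim_le_iff_height_le _).mpr fun Q hQ => ?_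
  obtain ⟨p, hp, hle⟩ := exists_under_le P S Q
  rw [← IsLocalization.height_under (⨅ p ∈ P, p.asIdeal.primeCompl : Submonoid R) Q]
  have h1 : ((Q.under R).height : WithBot ℕ∞) ≤ p.asIdeal.height := WithBot.coe_le_coe.mpr (Ideal.height_mono hle)
  rw [← IsLocalization.AtPrime.ringKrullDim_eq_height p.asIdeal (Localization.AtPrime p.asIdeal)] at h1
  exact h1.trans (h p hp)

/-- Each local dimension `dim R_p`, `p ∈ P`, is at most the dimension of the semi-local ring. [cite: Matsumura1987, §5] -/
theorem le_ringKrullDim_of_mem {p : PrimeSpectrum R} (hp : p ∈ P) : ringKrullDim (Localization.AtPrime p.asIdeal) ≤ ringKrullDim S := by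
  rw [IsLocalization.AtPrime.ringKrullDim_eq_height p.asIdeal (Localization.AtPrime p.asIdeal), ← height_map P S hp]
  haveI := isPrime_map P S hp
  exact Ideal.height_le_ringKrullDim_of_isPrime

/-- **If every `p ∈ P` has `dim R_p = n` (and `P ≠ ∅`) then the semi-local ring has dimension `n`.** [cite: Matsumura1987, §5] -/
theorem ringKrullDim_eq_of_forall_eq (hP : P.Nonempty) (n : ℕ) (h : ∀ p ∈ P, ringKrullDim (Localization.AtPrime p.asIdeal) = n) :
    ringKrullDim S = n := by
  obtain ⟨p₀, hp₀⟩ := hP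
  exact le_antisymm (ringKrullDim_le_of_forall P S n fun p hp => (h p hp).le) ((h p₀ hp₀).symm.le.trans (le_ringKrullDim_of_mem P S hp₀))

/-- Variant with arbitrary local rings `Rp p` of `R` at the primes of `P` (e.g. stalks of an affine scheme). [cite: Matsumura1987, §5] -/
theorem ringKrullDim_eq_of_forall_eq' (hP : P.Nonempty) (n : ℕ) (Rp : ∀ p ∈ P, Type*) [∀ p hp, CommRing (Rp p hp)]
    [∀ p hp, Algebra R (Rp p hp)] [∀ p hp, IsLocalization.AtPrime (Rp p hp) p.asIdeal] (h : ∀ p hp, ringKrullDim (Rp p hp) = n) :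
    ringKrullDim S = n := by
  refine ringKrullDim_eq_of_forall_eq P S hP n fun p hp => ?_
  rw [← h p hp, IsLocalization.AtPrime.ringKrullDim_eq_height p.asIdeal (Localization.AtPrime p.asIdeal),
    IsLocalization.AtPrime.ringKrullDim_eq_height p.asIdeal (Rp p hp)]

/-! ## §4 Quasi-excellence -/

/-- The semi-local ring of a quasi-excellent ring is quasi-excellent (Stacks 07QU, in the tree unconditionally). [cite: StacksProject, Tag 07QU] -/
theorem isQuasiExcellentRing (hR : IsQuasiExcellentRing R) : IsQuasiExcellentRing S :=
  isQuasiExcellentRing_of_isLocalization (⨅ p ∈ P, p.asIdeal.primeCompl : Submonoid R) hR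

/-- The semi-local ring of a finite type algebra over a field is quasi-excellent. [cite: StacksProject, Tag 07QW; Tag 07QU] -/
theorem isQuasiExcellentRing_of_finiteType (k : Type u) [Field k] [Algebra k R] [Algebra.FiniteType k R] : IsQuasiExcellentRing S :=
  isQuasiExcellentRing P S (isQuasiExcellentRing_of_finiteType_field k R)

/-! ## §5 Scheme words for `Spec S` and the product-compatible regular blow-up over the semi-local scheme -/

/-- `Spec` of the semi-local ring of a domain (nonempty `P`) is an integral scheme. [folklore] -/
theorem isIntegral_Spec [IsDomain R] (hP : P.Nonempty) : IsIntegral (Spec (.of S)) := by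
  haveI : IsDomain S := isDomain P S hP
  haveI : IsDomain (CommRingCat.of S) := ‹IsDomain S›
  infer_instance

/-- `Spec` of the semi-local ring of a Noetherian ring is a Noetherian scheme. [folklore] -/
theorem isNoetherian_Spec [IsNoetherianRing R] : IsNoetherian (Spec (.of S)) := by
  haveI : IsNoetherianRing S := IsLocalization.isNoetherianRing (⨅ p ∈ P, p.asIdeal.primeCompl : Submonoid R) S inferInstance
  haveI : IsNoetherianRing (CommRingCat.of S) := ‹IsNoetherianRing S›
  infer_instance

/-- `Spec` of the semi-local ring of a quasi-excellent ring is a quasi-excellent scheme. [cite: StacksProject, Tag 07QU] -/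
theorem isQuasiExcellent_Spec (hR : IsQuasiExcellentRing R) : Scheme.IsQuasiExcellent (Spec (.of S)) :=
  Scheme.isQuasiExcellent_of_locallyOfFiniteType_of_isQuasiExcellentRing Stacks07QU_holds (isQuasiExcellentRing P S hR) (𝟙 _)

/-- `dim Spec S = n` when every `p ∈ P` has `dim R_p = n`. [cite: Matsumura1987, §5] -/
theorem topologicalKrullDim_Spec_eq (hP : P.Nonempty) (n : ℕ) (h : ∀ p ∈ P, ringKrullDim (Localization.AtPrime p.asIdeal) = n) :
    topologicalKrullDim (Spec (.of S)) = n := by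
  change topologicalKrullDim (PrimeSpectrum S) = n
  rw [PrimeSpectrum.topologicalKrullDim_eq_ringKrullDim]
  exact ringKrullDim_eq_of_forall_eq P S hP n h

/-- **(b1) over the semi-local scheme.** `R` a quasi-excellent Noetherian domain, `P ≠ ∅` a finite set of primes each of local dimension
`dim R_p = 3`, `S` the semi-local ring: for every ideal sheaf `J ≠ ⊥` on `Spec S` there is `𝔟 ≠ ⊥` such that the blowing up along the
PRODUCT `J · 𝔟` exists and is REGULAR, and every blowing up along `J · 𝔟` is regular — ONE cure simultaneously at all the primes of `P`.
Modulo CP 2019 Thm. 1.1, Raynaud–Gruson 5.2.2 and CP 2019 Prop. 4.4 BY NAME (`DominatingLocFixRegular.exists_isBlowup_mul_isRegular_of_dim_three`).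
[OURS · conditional-result] [cite: CossartPiltant2019, Thm. 1.1 (i)(ii); Prop. 4.4] [cite: RaynaudGruson1971, Thm. 5.2.2] -/
theorem exists_isBlowup_mul_isRegular_semiLocal
    (hG : CossartPiltant2019General.{u}) (h081R : Stacks081R.{u}) (hP4 : CossartPiltant2019Principalization.{u})
    [IsDomain R] [IsNoetherianRing R] (hR : IsQuasiExcellentRing R) (hP : P.Nonempty)
    (h3 : ∀ p ∈ P, ringKrullDim (Localization.AtPrime p.asIdeal) = 3)
    (J : (Spec (.of S)).IdealSheafData) (hJ : J ≠ ⊥) :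
    ∃ 𝔟 : (Spec (.of S)).IdealSheafData, 𝔟 ≠ ⊥ ∧
      (∃ (T : Scheme.{u}) (π : T ⟶ Spec (.of S)), IsBlowup π (J * 𝔟) ∧ Scheme.IsRegular T) ∧
      ∀ (T : Scheme.{u}) (π : T ⟶ Spec (.of S)), IsBlowup π (J * 𝔟) → Scheme.IsRegular T := by
  haveI := isIntegral_Spec P S hP
  haveI := isNoetherian_Spec P S
  exact DominatingLocFixRegular.exists_isBlowup_mul_isRegular_of_dim_three hG h081R hP4 (isQuasiExcellent_Spec P S hR)
    (topologicalKrullDim_Spec_eq P S hP 3 h3) J hJ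

/-- The same for a finite type domain over a field (quasi-excellence discharged). [OURS · conditional-result]
[cite: CossartPiltant2019, Thm. 1.1 (i)(ii); Prop. 4.4] [cite: StacksProject, Tag 07QW] -/
theorem exists_isBlowup_mul_isRegular_semiLocal_of_finiteType
    (hG : CossartPiltant2019General.{u}) (h081R : Stacks081R.{u}) (hP4 : CossartPiltant2019Principalization.{u})
    (k : Type u) [Field k] [Algebra k R] [Algebra.FiniteType k R] [IsDomain R] (hP : P.Nonempty)
    (h3 : ∀ p ∈ P, ringKrullDim (Localization.AtPrime p.asIdeal) = 3)
    (J : (Spec (.of S)).IdealSheafData) (hJ : J ≠ ⊥) :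
    ∃ 𝔟 : (Spec (.of S)).IdealSheafData, 𝔟 ≠ ⊥ ∧
      (∃ (T : Scheme.{u}) (π : T ⟶ Spec (.of S)), IsBlowup π (J * 𝔟) ∧ Scheme.IsRegular T) ∧
      ∀ (T : Scheme.{u}) (π : T ⟶ Spec (.of S)), IsBlowup π (J * 𝔟) → Scheme.IsRegular T := by
  haveI : IsNoetherianRing R := Algebra.FiniteType.isNoetherianRing k R
  exact exists_isBlowup_mul_isRegular_semiLocal P S hG h081R hP4 (isQuasiExcellentRing_of_finiteType_field k R) hP h3 J hJ

/-! ## §6 Per-point: the local rings of `R` at the primes of `P` are localisations of the semi-local ring -/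

/-- The semi-local submonoid is contained in each `p.primeCompl`, `p ∈ P`. [folklore] -/
theorem iInf_primeCompl_le {p : PrimeSpectrum R} (hp : p ∈ P) : (⨅ p ∈ P, p.asIdeal.primeCompl : Submonoid R) ≤ p.asIdeal.primeCompl :=
  (iInf_le _ p).trans (iInf_le _ hp)

/-- **Any local ring `T` of `R` at `p ∈ P` (e.g. the stalk of an affine scheme at the point `p`) is a localisation of the semi-local ring `S`**,
namely at the image of `p.primeCompl`, for any compatible `S`-algebra structure. [cite: Matsumura1987, Thm. 4.3] -/
theorem isLocalization_map_primeCompl {p : PrimeSpectrum R} (hp : p ∈ P) (T : Type u) [CommRing T] [Algebra R T] [Algebra S T]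
    [IsScalarTower R S T] [IsLocalization.AtPrime T p.asIdeal] :
    IsLocalization ((p.asIdeal.primeCompl).map (algebraMap R S)) T :=
  IsLocalization.isLocalization_of_submonoid_le S T (⨅ p ∈ P, p.asIdeal.primeCompl : Submonoid R) p.asIdeal.primeCompl
    (iInf_primeCompl_le P hp)

/-- **The localisation of the semi-local ring at `pS` is a localisation of `R` at `p`** (`S_{pS} = R_p`), for any `S`-algebra `T` that is
`S_{pS}`. [cite: Matsumura1987, Thm. 4.3] -/
theorem isLocalizationAtPrime_of_map {p : PrimeSpectrum R} (hp : p ∈ P) (T : Type u) [CommRing T] [Algebra R T] [Algebra S T]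
    [IsScalarTower R S T] [hT : @IsLocalization.AtPrime S _ T _ _ (p.asIdeal.map (algebraMap R S)) (isPrime_map P S hp)] :
    IsLocalization.AtPrime T p.asIdeal := by
  haveI := isPrime_map P S hp
  have h := IsLocalization.isLocalization_isLocalization_atPrime_isLocalization (⨅ p ∈ P, p.asIdeal.primeCompl : Submonoid R)
    (p := p.asIdeal.map (algebraMap R S)) T
  have hM : ((p.asIdeal.map (algebraMap R S)).comap (algebraMap R S)).primeCompl = p.asIdeal.primeCompl := by
    ext x
    rw [Ideal.mem_primeCompl_iff, Ideal.mem_primeCompl_iff, comap_map P S hp]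
  change IsLocalization ((p.asIdeal.map (algebraMap R S)).comap (algebraMap R S)).primeCompl T at h
  change IsLocalization p.asIdeal.primeCompl T
  rwa [hM] at h

end Summit.ResolutionOfSingularities.ResolutionOfSingularities.Theorems.FInjectiveMacaulayfication.SemiLocalScheme

end
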